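import Summits.Ventures.Crystal3D.Theorems.StickyWulffConstantPolycrystalWulffBoundRungGapCells
import Summits.Ventures.Crystal3D.Theorems.StickyWulffConstantPolycrystalWulffBoundMergingCalculus

/-!
# `PolycrystalWulffBound`, line `PolyDensity`: the reduction rung in the CRUX'S OWN VOCABULARY —
# `rung_gapCells_texture`: `Tex` texture + cell presentation + gap-feasible thresholds + budget ⇒
# `6·2^{1/3}(√2·Vol)^{2/3} ≤ En` (crux `stmt-Ventures-19482`)

Route `StickyWulffConstant` of the venture `Summits/Ventures/Crystal3D`, second prover lane (poly-p2,
gen 14).  `rung_gapCells` (…RungGapCells.lean) bounds `Fr + Σ t·facetArea` of a cell complex from below.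
Here the cells present the grains of a crux texture `Tex n G A c m` (`G f = ⋃_{j ∈ s f} Q_j`, classes
disjoint and covering), the frames of the cells are those of their grains, FEASIBILITY is asked per cell
in its grain's body, and the BUDGET hypothesis says that the total trim charge
`Σ_{j ≠ j'} t j j'·facetArea(cl Q_j ∩ {⟪nv j j', x⟫ = b j j'})` is at most the crux's wall energy
`Σ_{f ≠ g} (c f g / 2)·ι_{Dsc(m f g)}(G f, G g)`; conclusion `6·2^{1/3}(√2·Vol)^{2/3} ≤ En n G A c m`.
Free energies of cells and grains agree (`freeEnergy_eq_merged_texture`).  How to meet the budget: put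
`t = 0` between cells of one grain and on free contacts; on a wall between grains `f ≠ g` use
`t ≤ 1` (non-co-axial, `c ≥ 1`; `ι_{Ball} ≥` contact area) or `t ≤ (1/√6)·sin∠(nv, m f g)` (co-axial,
`c ≥ ½`; `sinSum_le_iota_of_polytopeCalculus`), present the charged facets so that the facet on the
separating plane IS the contact, and take the thresholds from …GapShifts.lean (trees) or from a
feasibility certificate (cycles).
WHAT THIS IS NOT: a feasibility or budget theorem; the crux is not claimed.
-/

noncomputable section

open scoped BigOperators InnerProductSpace ENNReal Pointwise
open MeasureTheory Filter Set

namespace Summit.Ventures.Crystal3D.Cruxes.PolycrystalWulffBound.PolyDensity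

open Summit.Ventures.Crystal3D.Theorems
open Summit.Ventures.Crystal3D.Cruxes.TextureLiminf.TexShadow (per polytope facetArea E3)
open Literature.MathematicalPhysics.StatisticalMechanics (fccStacking barlowStacking IsHaggSeq perimeter)

/-- **Rung `rung_gapCells_texture`** (the reduction in `Tex`/`En` form): see the module docstring. -/
theorem rung_gapCells_texture :
    let Λ : Set (EuclideanSpace ℝ (Fin 3)) := Literature.MathematicalPhysics.StatisticalMechanics.fccStacking 1 (Real.sqrt (2 / 3));
    let Brl : (ℤ → ℤ) → Set (EuclideanSpace ℝ (Fin 3)) := Literature.MathematicalPhysics.StatisticalMechanics.barlowStacking 1 (Real.sqrt (2 / 3));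
    let Ax : EuclideanSpace ℝ (Fin 3) → (EuclideanSpace ℝ (Fin 3) ≃ₗᵢ[ℝ] EuclideanSpace ℝ (Fin 3)) → (EuclideanSpace ℝ (Fin 3) ≃ₗᵢ[ℝ] EuclideanSpace ℝ (Fin 3)) → Prop := fun m A B => ∃ (L : EuclideanSpace ℝ (Fin 3) ≃ₗᵢ[ℝ] EuclideanSpace ℝ (Fin 3)) (s₁ s₂ : EuclideanSpace ℝ (Fin 3)) (σ σ' : ℤ → ℤ), Literature.MathematicalPhysics.StatisticalMechanics.IsHaggSeq σ ∧ Literature.MathematicalPhysics.StatisticalMechanics.IsHaggSeq σ' ∧ L (EuclideanSpace.single (2 : Fin 3) (1 : ℝ)) = m ∧ A '' Λ ⊆ (fun q => L q + s₁) '' Brl σ ∧ B '' Λ ⊆ (fun q => L q + s₂) '' Brl σ';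
    let CoAx : (EuclideanSpace ℝ (Fin 3) ≃ₗᵢ[ℝ] EuclideanSpace ℝ (Fin 3)) → (EuclideanSpace ℝ (Fin 3) ≃ₗᵢ[ℝ] EuclideanSpace ℝ (Fin 3)) → Prop := fun A B => ∃ m, Ax m A B;
    let Φ : EuclideanSpace ℝ (Fin 3) → ℝ := fun ν => Real.sqrt 2 / 4 * ∑ᶠ w ∈ {w ∈ Λ | ‖w‖ = 1}, |⟪w, ν⟫_ℝ|;
    let Per : Set (EuclideanSpace ℝ (Fin 3)) → Set (EuclideanSpace ℝ (Fin 3)) → ℝ := fun K S => (⨆ (ξ : EuclideanSpace ℝ (Fin 3) → EuclideanSpace ℝ (Fin 3)) (_ : ContDiff ℝ 1 ξ ∧ HasCompactSupport ξ ∧ ∀ z, ξ z ∈ K), ENNReal.ofReal (∫ z in S, Literature.MathematicalPhysics.StatisticalMechanics.fieldDivergence ξ z)).toReal;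
    let ι : Set (EuclideanSpace ℝ (Fin 3)) → Set (EuclideanSpace ℝ (Fin 3)) → Set (EuclideanSpace ℝ (Fin 3)) → ℝ := fun K S₁ S₂ => (Per K S₁ + Per K S₂ - Per K (S₁ ∪ S₂)) / 2;
    let W : (EuclideanSpace ℝ (Fin 3) ≃ₗᵢ[ℝ] EuclideanSpace ℝ (Fin 3)) → Set (EuclideanSpace ℝ (Fin 3)) := fun A => {y | ∀ ν : EuclideanSpace ℝ (Fin 3), ⟪y, ν⟫_ℝ ≤ Φ (A.symm ν)};
    let Dsc : EuclideanSpace ℝ (Fin 3) → Set (EuclideanSpace ℝ (Fin 3)) := fun m => {y | ‖y‖ ≤ 1 ∧ ⟪y, m⟫_ℝ = 0};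
    let Tex : (n : ℕ) → (Fin n → Set (EuclideanSpace ℝ (Fin 3))) → (Fin n → (EuclideanSpace ℝ (Fin 3) ≃ₗᵢ[ℝ] EuclideanSpace ℝ (Fin 3))) → (Fin n → Fin n → ℝ) → (Fin n → Fin n → EuclideanSpace ℝ (Fin 3)) → Prop := fun n G A c m => (∀ f : Fin n, Literature.MathematicalPhysics.StatisticalMechanics.HasFinitePerimeter (G f) ∧ volume (G f) < ⊤) ∧ (∀ f g, f ≠ g → Disjoint (G f) (G g)) ∧ (∀ f g, f ≠ g → 0 ≤ c f g) ∧ (∀ f g, f ≠ g → ¬ CoAx (A f) (A g) → m f g = 0 ∧ 1 ≤ c f g) ∧ (∀ f g, f ≠ g → CoAx (A f) (A g) → A f '' Λ ≠ A g '' Λ → Ax (m f g) (A f) (A g) ∧ 1 / 2 ≤ c f g);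
    let En : (n : ℕ) → (Fin n → Set (EuclideanSpace ℝ (Fin 3))) → (Fin n → (EuclideanSpace ℝ (Fin 3) ≃ₗᵢ[ℝ] EuclideanSpace ℝ (Fin 3))) → (Fin n → Fin n → ℝ) → (Fin n → Fin n → EuclideanSpace ℝ (Fin 3)) → ℝ := fun n G A c m => ∑ f : Fin n, Per (W (A f)) (G f) - ∑ f, ∑ g, (if f = g then 0 else ι (W (A f)) (G f) (G g)) + ∑ f, ∑ g, (if f = g then 0 else c f g / 2 * ι (Dsc (m f g)) (G f) (G g));
    let Vol : (n : ℕ) → (Fin n → Set (EuclideanSpace ℝ (Fin 3))) → ℝ := fun n G => (volume (⋃ f : Fin n, G f)).toReal;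
    ∀ (k' : ℕ) (Hc : Fin k' → Finset ((EuclideanSpace ℝ (Fin 3)) × ℝ)) (nv : Fin k' → Fin k' → EuclideanSpace ℝ (Fin 3))
      (b : Fin k' → Fin k' → ℝ),
      (∀ j, Bornology.IsBounded (polytope (Hc j))) →
      (∀ j, ∀ p ∈ Hc j, ‖p.1‖ = 1) →
      (∀ i j, nv j i = -nv i j) → (∀ i j, b j i = -b i j) →
      (∀ j j', j ≠ j' → ‖nv j j'‖ = 1) →
      (∀ j j', j ≠ j' → polytope (Hc j) ⊆ {x | ⟪nv j j', x⟫_ℝ < b j j'}) →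
    ∀ (n : ℕ) (G : Fin n → Set (EuclideanSpace ℝ (Fin 3)))
      (A : Fin n → (EuclideanSpace ℝ (Fin 3) ≃ₗᵢ[ℝ] EuclideanSpace ℝ (Fin 3)))
      (c : Fin n → Fin n → ℝ) (m : Fin n → Fin n → EuclideanSpace ℝ (Fin 3)),
      Tex n G A c m →
    ∀ (s : Fin n → Finset (Fin k')),
      (∀ f, G f = ⋃ j ∈ s f, polytope (Hc j)) →
      (∀ f g, f ≠ g → Disjoint (s f) (s g)) →
      (∀ j, ∃ f, j ∈ s f) →
    ∀ (τ t : Fin k' → Fin k' → ℝ), (∀ j j', 0 ≤ t j j') → (∀ j j', j ≠ j' → τ j j' + τ j' j ≤ t j j' + t j' j) →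
      (∀ f, ∀ j ∈ s f, ENNReal.ofReal (32 * ((volume (polytope (Hc j))).toReal / Vol n G)) ≤
        volume (W (A f) ∩ ⋂ j' ∈ Finset.univ.filter (fun j' => j' ≠ j), {y | ⟪y, nv j j'⟫_ℝ ≤ τ j j'})) →
      (∑ j, ∑ j', (if j = j' then 0 else t j j' *
          facetArea (closure (polytope (Hc j)) ∩ {x | ⟪nv j j', x⟫_ℝ = b j j'}) (nv j j')) ≤
        ∑ f, ∑ g, (if f = g then 0 else c f g / 2 * ι (Dsc (m f g)) (G f) (G g))) →
    6 * (2 : ℝ) ^ ((1 : ℝ) / 3) * (Real.sqrt 2 * Vol n G) ^ ((2 : ℝ) / 3) ≤ En n G A c m := by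
  intro Λ Brl Ax CoAx Φ Per ι W Dsc Tex En Vol k' Hc nv b hbd hunitH hanti hbanti hunit hsep n G A c m hTex
    s hGs hsdisj hcov τ t ht0 hgap hfeas hbudget
  classical
  obtain ⟨hfin, hdisjG, -, -, -⟩ := hTex
  have hvol : ∀ f, volume (G f) < ⊤ := fun f => (hfin f).2
  rcases Nat.eq_zero_or_pos n with hn | hn
  · subst hn
    show 6 * (2 : ℝ) ^ ((1 : ℝ) / 3) * (Real.sqrt 2 * (volume (⋃ f : Fin 0, G f)).toReal) ^ ((2 : ℝ) / 3) ≤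
      ∑ f : Fin 0, Per (W (A f)) (G f) - ∑ f : Fin 0, ∑ g, (if f = g then 0 else ι (W (A f)) (G f) (G g)) +
        ∑ f : Fin 0, ∑ g, (if f = g then 0 else c f g / 2 * ι (Dsc (m f g)) (G f) (G g))
    rw [iUnion_of_empty, measure_empty, ENNReal.toReal_zero, mul_zero, Real.zero_rpow (by norm_num),
      mul_zero]
    simp
  -- cells, their grains
  set Q : Fin k' → Set E3 := fun j => polytope (Hc j) with hQ
  choose gr hgr using hcov
  have hgr_eq : ∀ j f, j ∈ s f → gr j = f := by
    intro j f hj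
    by_contra h
    exact Finset.disjoint_left.1 (hsdisj _ _ h) (hgr j) hj
  have hfilter : ∀ f, Finset.univ.filter (fun j => gr j = f) = s f := by
    intro f; ext j
    simp only [Finset.mem_filter, Finset.mem_univ, true_and]
    exact ⟨fun h => h ▸ hgr j, fun h => hgr_eq j f h⟩
  have hQpoly : ∀ j, ∃ (k : ℕ) (H' : Fin k → Finset (E3 × ℝ)), Q j = ⋃ i, polytope (H' i) :=
    fun j => ⟨1, fun _ => Hc j, by ext x; simp [hQ]⟩
  have hQvol : ∀ j, volume (Q j) < ⊤ := fun j => (hbd j).measure_lt_top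
  have hdisjQ : ∀ j j', j ≠ j' → Disjoint (Q j) (Q j') := by
    intro j j' hjj'
    rw [Set.disjoint_left]
    intro x hx hx'
    have h1 : ⟪nv j j', x⟫_ℝ < b j j' := hsep j j' hjj' hx
    have h2 : ⟪nv j' j, x⟫_ℝ < b j' j := hsep j' j (Ne.symm hjj') hx'
    rw [hanti j j', hbanti j j', inner_neg_left] at h2
    linarith
  -- (i) volumes agree
  have hUnion : (⋃ j, ⋂ p ∈ Hc j, {x : E3 | ⟪p.1, x⟫_ℝ < p.2}) = ⋃ f, G f := by
    apply subset_antisymm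
    · intro x hx
      obtain ⟨j, hj⟩ := mem_iUnion.1 hx
      refine mem_iUnion.2 ⟨gr j, ?_⟩
      rw [hGs]
      exact mem_biUnion (hgr j) hj
    · intro x hx
      obtain ⟨f, hf⟩ := mem_iUnion.1 hx
      rw [hGs] at hf
      obtain ⟨j, -, hj⟩ := mem_iUnion₂.1 hf
      exact mem_iUnion.2 ⟨j, hj⟩
  -- the cell rung
  have hR := rung_gapCells k' Hc (fun j => A (gr j)) nv b τ t hbd hunitH hanti hbanti hunit hsep ht0 hgap
    (fun j => by
      have h := hfeas (gr j) j (hgr j)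
      have e : (volume (⋃ j, ⋂ p ∈ Hc j, {x : E3 | ⟪p.1, x⟫_ℝ < p.2})).toReal = (volume (⋃ f, G f)).toReal := by
        rw [hUnion]
      show ENNReal.ofReal (32 * ((volume (⋂ p ∈ Hc j, {x : E3 | ⟪p.1, x⟫_ℝ < p.2})).toReal /
          (volume (⋃ j, ⋂ p ∈ Hc j, {x : E3 | ⟪p.1, x⟫_ℝ < p.2})).toReal)) ≤ _
      rw [e]
      exact h)
  -- (ii) free energies agree: merge the cells of each grain
  have hWc : ∀ f, IsCompact (W (A f)) := fun f => isCompact_cruxWulffBody (A f)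
  have hWv : ∀ f, Convex ℝ (W (A f)) := fun f => convex_cruxWulffBody (A f)
  have hW0 : ∀ f, (0 : E3) ∈ W (A f) := fun f => zero_mem_cruxWulffBody (A f)
  have hWs : ∀ f, -W (A f) = W (A f) := fun f => neg_cruxWulffBody_eq (A f)
  have hmerge := freeEnergy_eq_merged_texture Q hQpoly hQvol hdisjQ gr Finset.univ
    (fun j => Finset.mem_univ _) (fun f => W (A f)) hWc hWv hW0 hWs
  have hUf : ∀ f, (⋃ j ∈ Finset.univ.filter (fun j => gr j = f), Q j) = G f := by
    intro f; rw [hfilter, hGs]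
  simp only [hUf] at hmerge
  have hFr : (∑ j, Per (W (A (gr j))) (⋂ p ∈ Hc j, {x : E3 | ⟪p.1, x⟫_ℝ < p.2}) -
      ∑ j, ∑ j', (if j = j' then 0 else ι (W (A (gr j))) (⋂ p ∈ Hc j, {x : E3 | ⟪p.1, x⟫_ℝ < p.2})
        (⋂ p ∈ Hc j', {x : E3 | ⟪p.1, x⟫_ℝ < p.2}))) =
      ∑ f, Per (W (A f)) (G f) - ∑ f, ∑ g, (if f = g then 0 else ι (W (A f)) (G f) (G g)) := by
    rw [← Finset.sum_sub_distrib, ← Finset.sum_sub_distrib]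
    exact hmerge
  -- (iii) assemble
  show 6 * (2 : ℝ) ^ ((1 : ℝ) / 3) * (Real.sqrt 2 * (volume (⋃ f, G f)).toReal) ^ ((2 : ℝ) / 3) ≤
    ∑ f, Per (W (A f)) (G f) - ∑ f, ∑ g, (if f = g then 0 else ι (W (A f)) (G f) (G g)) +
      ∑ f, ∑ g, (if f = g then 0 else c f g / 2 * ι (Dsc (m f g)) (G f) (G g))
  have hR' : 6 * (2 : ℝ) ^ ((1 : ℝ) / 3) * (Real.sqrt 2 * (volume (⋃ f, G f)).toReal) ^ ((2 : ℝ) / 3) ≤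
      (∑ f, Per (W (A f)) (G f) - ∑ f, ∑ g, (if f = g then 0 else ι (W (A f)) (G f) (G g))) +
        ∑ j, ∑ j', (if j = j' then 0 else t j j' *
          facetArea (closure (polytope (Hc j)) ∩ {x | ⟪nv j j', x⟫_ℝ = b j j'}) (nv j j')) := by
    refine le_trans (le_of_eq ?_) (le_trans hR (le_of_eq ?_))
    · show _ = 6 * (2 : ℝ) ^ ((1 : ℝ) / 3) *
        (Real.sqrt 2 * (volume (⋃ j, ⋂ p ∈ Hc j, {x : E3 | ⟪p.1, x⟫_ℝ < p.2})).toReal) ^ ((2 : ℝ) / 3)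
      rw [hUnion]
    · show (∑ j, Per (W (A (gr j))) (⋂ p ∈ Hc j, {x : E3 | ⟪p.1, x⟫_ℝ < p.2}) -
          ∑ j, ∑ j', (if j = j' then 0 else ι (W (A (gr j))) (⋂ p ∈ Hc j, {x : E3 | ⟪p.1, x⟫_ℝ < p.2})
            (⋂ p ∈ Hc j', {x : E3 | ⟪p.1, x⟫_ℝ < p.2}))) +
          ∑ j, ∑ j', (if j = j' then 0 else t j j' *
            facetArea (closure (⋂ p ∈ Hc j, {x : E3 | ⟪p.1, x⟫_ℝ < p.2}) ∩ {x | ⟪nv j j', x⟫_ℝ = b j j'})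
              (nv j j')) = _
      rw [hFr]
      rfl
  linarith only [hR', hbudget]

end Summit.Ventures.Crystal3D.Cruxes.PolycrystalWulffBound.PolyDensity

end
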